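import Literature.Analysis.FluidPDE.Tao2016AveragedNS.SplitCascadeBlowupDynamicsWith
import HarnessLib

/-!
# Tao's cascade ODE with the squared modes doubled, I-ter: a concrete family of checkpoint
# asymmetry clauses (pointwise at the checkpoint, all shells from the previous one upward, with
# lower bounds on the dormant clocks), and the reduction specialised to it

T. Tao, *Finite time blowup for an averaged three-dimensional Navier–Stokes equation*, J. Amer.
Math. Soc. **29** (2016) 601–674 = arXiv:1402.0290v3, §6.2 Prop. 6.3 (the checkpoint bounds
(6.15)–(6.20) are POINTWISE at `t_n`), §6.3 Prop. 6.4 [`Tao2016AveragedNS`].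

HONEST FRAMING (cell harvest/h2-tao-ladder, rung 1 of a ladder of MODEL equations; RUNG1-HANDOFF h4 /
R1-b): `SplitCascadeBlowupDynamicsWith.lean` reduces "no global solution of `SplitODESystem`" to an
inductive step `splitBlowupDynamicsStepWith γ P` for ANY invariant `P` true at the datum. This file
records ONE concrete, parametric candidate for `P` — the shape the cell's analysis (rung1/
ATTEMPT-p1g3.md §2) says the step needs — and proves the two trivial facts about it: it holds at
the datum, and the reduction specialises to it. The clauses, at checkpoint `N` (time `t_N`,
amplitude `e_N`), with free profiles `η : ℤ → ℝ` and `β : ℕ → ℝ` (to be chosen as functions of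
`ε₀, K, ε, n₀` by whoever proves the step): (Z) `|Z_{i,N+m}(t_N)| ≤ η(m)·e_N` for every `m ≥ -1`
(previous shell `m = -1`, fresh shell `m = 0`, DORMANT shells `m ≥ 1` — energy bounds alone do not
make the dormant asymmetries `n₀`-small, so they are tracked from `t = 0`), and (B) the dormant clocks
are not too negative, `b_{N+m}(t_N) ≥ -β(m)·e_N` for `m ≥ 1` (channel (A) of a dormant shell
amplifies at rate `Λε⁻¹K¹⁰b⁻`). Pointwise-at-checkpoint clauses suffice as HYPOTHESES because the
in-window bounds follow by Grönwall (`SplitCascadeChannels.lean`). Whether this family closes the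
induction is NOT claimed; nothing here concerns Navier–Stokes.
-/

noncomputable section

open Set

namespace Literature.Analysis.FluidPDE.Tao2016AveragedNS

open TaoCascade

/-- **The candidate asymmetry invariant at checkpoint `N`** (profiles `η : ℤ → ℝ`, `β : ℕ → ℝ`):
(Z) for every `m : ℕ` and the previous shell, `|Z_{i,N+m}(t_N)| ≤ η(m)·e_N` and
`|Z_{i,N-1}(t_N)| ≤ η(-1)·e_N`; (B) for every `m ≥ 1`, `b_{N+m}(t_N) ≥ -β(m)·e_N`. In the format
`P ε₀ K ε n₀ S Z E N t e` of `splitBlowupDynamicsStepWith` (the first four arguments are unused by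
the clauses themselves; `η, β` may depend on them). [cite: Tao2016AveragedNS, §6.2 Prop. 6.3] -/
def SplitAsymmetryProfile (η : ℤ → ℝ) (β : ℕ → ℝ) (_ε₀ _K _ε : ℝ) (n₀ : ℤ)
    (S : Fin 4 → ℤ → ℝ → ℝ) (Z : Fin 3 → ℤ → ℝ → ℝ) (_E : ℤ → ℝ → ℝ) (N : ℤ) (t e : ℤ → ℝ) :
    Prop :=
  (∀ (i : Fin 3) (m : ℕ), |Z i (N + m) (t N)| ≤ η m * e N) ∧
    (n₀ < N → ∀ i : Fin 3, |Z i (N - 1) (t N)| ≤ η (-1) * e N) ∧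
    ∀ m : ℕ, 1 ≤ m → -(β m * e N) ≤ S 1 (N + m) (t N)

/-- **The candidate invariant holds at the datum** (`N = n₀`, `t ≡ 0`, `e ≡ 1`) for non-negative
profiles: `Z(0) = 0` and the dormant clocks vanish at `t = 0` ((6.6♯)).
[cite: Tao2016AveragedNS, §6.3 p. 53] -/
theorem SplitODESystem.splitAsymmetryProfile_base {ε₀ K ε C₁ C₂ : ℝ} {n₀ : ℤ}
    {S : Fin 4 → ℤ → ℝ → ℝ} {Z : Fin 3 → ℤ → ℝ → ℝ} {E : ℤ → ℝ → ℝ}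
    (hsol : SplitODESystem ε₀ K ε C₁ C₂ n₀ S Z E) {η : ℤ → ℝ} {β : ℕ → ℝ} (hη : ∀ m, 0 ≤ η m)
    (hβ : ∀ m, 0 ≤ β m) :
    SplitAsymmetryProfile η β ε₀ K ε n₀ S Z E n₀ (fun _ => 0) (fun _ => 1) := by
  refine ⟨fun i m => ?_, fun h => absurd h (lt_irrefl _), fun m hm => ?_⟩
  · rw [hsol.init_Z]; simpa using hη m
  · have h0 : S 1 (n₀ + m) 0 = 0 := by
      rw [hsol.init_S]; simp
    rw [h0]; simpa using hβ m

/-- **Theorem 6.2♯ from the inductive step for the candidate invariant (PROVED reduction).** If for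
some coefficient `γ ≥ 0` in (6.17) and some non-negative profiles `η, β` (allowed to depend on
`ε₀, K, ε, n₀`) the step `splitBlowupDynamicsStepWith γ (SplitAsymmetryProfile η β)` holds, then the
split system has no global solution in Tao's regime. [cite: Tao2016AveragedNS, §6.2–6.3 p. 53] -/
theorem noGlobalSplit_of_profileStep {γ : ℝ → ℝ} (hγ : ∀ K, 0 < K → 0 ≤ γ K)
    {η : ℝ → ℝ → ℝ → ℤ → ℤ → ℝ} {β : ℝ → ℝ → ℝ → ℤ → ℕ → ℝ}
    (hη : ∀ ε₀ K ε n₀ m, 0 ≤ η ε₀ K ε n₀ m) (hβ : ∀ ε₀ K ε n₀ m, 0 ≤ β ε₀ K ε n₀ m)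
    (h : splitBlowupDynamicsStepWith γ fun ε₀ K ε n₀ =>
      SplitAsymmetryProfile (η ε₀ K ε n₀) (β ε₀ K ε n₀) ε₀ K ε n₀) :
    ∀ ε₀ : ℝ, 0 < ε₀ → ε₀ < 1 →
      ∃ K₀ : ℝ, ∀ K : ℝ, K₀ ≤ K → 0 < K →
        ∃ e₀ : ℝ, 0 < e₀ ∧ ∀ ε : ℝ, 0 < ε → ε ≤ e₀ →
          ∀ C₁ C₂ : ℝ, 0 ≤ C₁ → 0 ≤ C₂ →
            ∃ N₀ : ℤ, ∀ n₀ : ℤ, N₀ ≤ n₀ →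
              ¬ ∃ (S : Fin 4 → ℤ → ℝ → ℝ) (Z : Fin 3 → ℤ → ℝ → ℝ) (E : ℤ → ℝ → ℝ),
                SplitODESystem ε₀ K ε C₁ C₂ n₀ S Z E :=
  noGlobalSplit_of_splitBlowupDynamicsStepWith hγ
    (fun ε₀ K ε _ _ n₀ _ _ _ hsol => hsol.splitAsymmetryProfile_base (hη ε₀ K ε n₀) (hβ ε₀ K ε n₀)) h

end Literature.Analysis.FluidPDE.Tao2016AveragedNS
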